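import Literature.MathematicalPhysics.QuantumLattice.StrongExpDecaySlabKernels
import Literature.MathematicalPhysics.QuantumLattice.WilsonLoopsProofs
import HarnessLib

/-!
# Chatterjee's Theorem 2.4, quantitative half: under Definition 2.3 the confinement function `V(R)` grows
# linearly — `|⟨W_{R×T}⟩| ≤ m^{⌊T/n⌋+2} (C₁ e^{−C₂ R})^{⌊T/n⌋}` (CMP 385 (2021), eq. (12.1))

S. Chatterjee, *A probabilistic mechanism for quark confinement*, CMP **385** (2021) [Chatterjee2021], §12, second paragraph:
«if `f` is a vertical chain variable associated with the vertical chain through the center of `S_{M,N}`, its expected value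
in `S_{M,N}` must tend to its expected value under the unique Gibbs measure on the infinite slab exponentially fast in `M` …
But its expected value under the Gibbs measure must be zero due to center symmetry … This shows that the function `V` from
Lemma 3.1 must have at least linear growth. Thus, from the proof of Theorem 2.2, … `|⟨W_ℓ⟩| ≤ e^{(C₁−C₂R)T}` (12.1)».

Here, for EVERY compact metrisable gauge group (no connectedness, no infinite-slab state): the kernel expectation of a
column variable through the centre of the finite slab `slabBox n R` under boundary condition `η` and under its CENTRE
TRANSFORM `τη` differ by at most `8n e^{−κ⌊(R−1)/(n+2)⌋}` (`abs_integral_sub_integral_slabBox_le_of_strongExpDecayZd`: the two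
boundary conditions agree on the temporal faces), while the second equals `c` times the first (`τ` is a symmetry of the slab
specification, `slabSpecification_map_centreTransform`, and multiplies the column variable by the central scalar `c = π(g₀) ≠ 1`,
`colMat_centreTransform`); hence `|1 − c| · |⟨col⟩_{R,η}| ≤ 8n e^{−κ⌊(R−1)/(n+2)⌋}`:

* `colSup_le_exp_of_strongExpDecayZd_uniform` — `s(R) ≤ C₁ e^{−C₂ R}` for the tree's `colSup` (Lemma 3.1's `sup_{f,δ}|⟨f⟩_{R,δ}|`),
  `n ≥ n₀`;
* ★ `norm_integral_trace_rect_le_exp_of_hasStrongExpDecayZd` — **eq. (12.1)**: for an irreducible continuous unitary `π`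
  acting non-trivially on the centre there are `n ≥ 1`, `C₁, C₂ > 0` with
  `‖∫ tr π(hol_{R×T}) dμ‖ ≤ m^{⌊T/n⌋+2} (C₁ e^{−C₂R})^{⌊T/n⌋}` for every DLR state, base point, plane and `R ≥ 1` — the
  tree's Theorem 2.2 engine `norm_integral_trace_rect_le` fed with the exponential `s(R)`.

Not here: the removal of the `m^{⌊T/n⌋}`/`C₁^{⌊T/n⌋}` factor for small `R` (the printed Lemmas 12.1–12.3, perimeter-law
upper bound), which completes the area law `|⟨W_ℓ⟩| ≤ C₁ e^{−C₂ RT}` of Thm. 2.4 (second assertion; named fact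
`chatterjee2021_areaLaw_of_strongExpDecay`).

## References
* S. Chatterjee, CMP 385 (2021), arXiv:2006.16229: §3 (Lemma 3.1, proof of Thm. 2.2), §12 eq. (12.1).
-/

noncomputable section

open MeasureTheory Filter Function Finset
open scoped Topology

namespace Literature.MathematicalPhysics.QuantumLattice

open Literature.Probability.LatticeModels

section Slab

variable {d N m : ℕ} {G : Type*} [Group G] [TopologicalSpace G] [IsTopologicalGroup G]
  [CompactSpace G] [MeasurableSpace G] [BorelSpace G] [SecondCountableTopology G] [T2Space G] [NeZero d]
  (ρ : G →* Matrix (Fin N) (Fin N) ℂ) (π : G →* Matrix (Fin m) (Fin m) ℂ)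

/-! ### §1 The column kernels decay exponentially in the radius of the finite slab -/

/-- ★ **Chatterjee 2021, §12: `V` has at least linear growth** — under Def. 2.3 (`K₂ > 0`, `|Re tr ρ(U_p)| ≤ C`) there is
`n₀ ≥ 2` such that for every slab height `n ≥ n₀` and every continuous unitary `π` with a central `g₀`, `π(g₀) = c·1`,
`c ≠ 1`, the suprema `s(R) = colSup d ρ π β n R` of the column kernels of the finite slabs (Lemma 3.1) satisfy
`s(R) ≤ C₁ e^{−C₂ R}` for all `R ≥ 1`, with `C₁, C₂ > 0` independent of `R`. Proof: compare the boundary conditions `η` and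
`τ_{g₀} η` (they agree on the temporal faces) by `abs_integral_sub_integral_slabBox_le_of_strongExpDecayZd`, and use
`⟨col⟩_{R, τη} = c ⟨col⟩_{R, η}` (symmetry of the specification + `col ∘ τ = c · col`). Uniform in the height `n ≥ n₀`
and in `π`; the sibling `CentreSymmetryAreaLaw.lean` has a fixed-`π` form under the shorter name (renamed here to keep
the two modules co-importable). [cite: Chatterjee2021, §12 (eq. (12.1), linear growth of V)] -/
theorem colSup_le_exp_of_strongExpDecayZd_uniform (hρ : Continuous ρ) {C : ℝ} (hC0 : 0 ≤ C)
    (hC : ∀ (x : Site d) (i j : Fin d) (U : LGConfig d G), |plaquetteObs ρ x i j U| ≤ C)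
    {β K₁ K₂ : ℝ} (hdecay : StrongExpDecayZd d ρ β K₁ K₂) (hK₂ : 0 < K₂) :
    ∃ n₀ : ℕ, 2 ≤ n₀ ∧ ∀ n, n₀ ≤ n → ∀ (π : G →* Matrix (Fin m) (Fin m) ℂ), Continuous π →
      (∀ g, π g ∈ Matrix.unitaryGroup (Fin m) ℂ) → ∀ {g₀ : G}, g₀ ∈ Subgroup.center G →
      ∀ {c : ℂ}, π g₀ = c • (1 : Matrix (Fin m) (Fin m) ℂ) → c ≠ 1 →
      ∃ C₁ C₂ : ℝ, 0 < C₁ ∧ 0 < C₂ ∧ ∀ R : ℕ, 1 ≤ R → colSup d ρ π β n R ≤ C₁ * Real.exp (-(C₂ * R)) := by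
  classical
  obtain ⟨n₀, hn₀, hker⟩ := abs_integral_sub_integral_slabBox_le_of_strongExpDecayZd ρ hρ hC0 hC hdecay hK₂
  refine ⟨n₀, hn₀, fun n hn π hπ hπu g₀ hg₀ c hc hc1 => ?_⟩
  obtain ⟨κ, hκ, hbound⟩ := hker n hn
  have hn1 : 1 ≤ n := by omega
  have h1c : 0 < ‖(1 : ℂ) - c‖ := norm_pos_iff.2 (sub_ne_zero.2 (Ne.symm hc1))
  refine ⟨8 * n * Real.exp κ / ‖(1 : ℂ) - c‖, κ / (n + 2), by positivity, by positivity, fun R hR => ?_⟩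
  have hγ := QuantumFieldTheory.isSpecification_ymSpecification_of_t2Space (d := d) ρ hρ β
  -- the bound for one boundary condition and one matrix entry
  have hentry : ∀ (η : LGConfig d G) (a b : Fin m),
      ‖∫ U, colMat π U 0 n a b ∂(ymSpecification ρ β (slabBox n R) η)‖ ≤
        8 * n * Real.exp κ / ‖(1 : ℂ) - c‖ * Real.exp (-(κ / (n + 2) * R)) := by
    intro η a b
    set Λ : Finset (ZdEdge d) := slabBox n R with hΛ
    haveI : ∀ ζ : LGConfig d G, IsProbabilityMeasure (ymSpecification ρ β Λ ζ) := fun ζ => hγ.isProbability Λ ζ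
    set f : LGConfig d G → ℂ := fun U => colMat π U 0 n a b with hf
    have hfc : Continuous f := by
      have := continuous_colMat (d := d) π hπ n 0
      exact (continuous_apply b).comp ((continuous_apply a).comp this)
    have hf1 : ∀ U, ‖f U‖ ≤ 1 := fun U => norm_colMat_apply_le_one π hπu U 0 n a b
    have hfi : ∀ ζ, Integrable f (ymSpecification ρ β Λ ζ) := fun ζ =>
      Integrable.of_bound hfc.aestronglyMeasurable 1 (ae_of_all _ hf1)
    set I : ℂ := ∫ U, f U ∂(ymSpecification ρ β Λ η) with hI
    set I' : ℂ := ∫ U, f U ∂(ymSpecification ρ β Λ (centreTransform g₀ η)) with hI'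
    -- (i) the transformed boundary condition gives `c I`
    have hΛint : Λ.filter (IsSlabInteriorEdge (d := d) n) = Λ :=
      Finset.filter_true_of_mem fun e he => isSlabInteriorEdge_of_mem_slabBox he
    have hmap : (ymSpecification ρ β Λ η).map (centreTransform g₀) = ymSpecification ρ β Λ (centreTransform g₀ η) := by
      have h := slabSpecification_map_centreTransform ρ hρ hg₀ β n Λ η
      simpa only [slabSpecification, hΛint] using h
    have hfτ : ∀ U, f (centreTransform g₀ U) = c * f U := fun U => by
      obtain ⟨n', rfl⟩ : ∃ n', n = n' + 1 := ⟨n - 1, by omega⟩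
      simp only [hf]
      rw [colMat_centreTransform π hc U (y := (0 : Site d)) rfl n', Matrix.smul_apply, smul_eq_mul]
    have hI'c : I' = c * I := by
      rw [hI', ← hmap, integral_map (measurable_centreTransform g₀).aemeasurable hfc.aestronglyMeasurable]
      simp_rw [hfτ]
      rw [integral_const_mul]
    -- (ii) the two boundary conditions agree off the interior slab links, so the kernels are close on `Re f`, `Im f`
    have hagree : ∀ e, ¬ IsSlabInteriorEdge n e → η e = centreTransform g₀ η e := fun e he => by
      refine (centreTransform_apply_of_neg g₀ η fun h => he ?_).symm
      exact isSlabInteriorEdge_of_bottom hn1 h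
    set δ : ZdEdge d → ℝ := fun x => if x ∈ colEdges (0 : Site d) n then 2 else 0 with hδ
    have hδ0 : ∀ x, 0 ≤ δ x := fun x => by simp only [hδ]; split_ifs <;> norm_num
    have hδS : ∀ x, δ x ≠ 0 → ∀ k : Fin d, k ≠ 0 → |x.1 k| ≤ ((0 : ℕ) : ℤ) := by
      intro x hx k hk
      have hxc : x ∈ colEdges (0 : Site d) n := by
        by_contra h; exact hx (by simp only [hδ, if_neg h])
      obtain ⟨t, -, hxt⟩ := mem_colEdges.1 hxc
      have h1 : x.1 k = ((0 : Site d) + (Pi.single (0 : Fin d) (t : ℤ) : Site d)) k := by rw [hxt]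
      rw [h1, Pi.add_apply, Pi.zero_apply, Pi.single_eq_of_ne hk, add_zero, abs_zero, Nat.cast_zero]
    have hsumδ : ∑ x ∈ Λ, δ x ≤ 2 * n := by
      rw [hδ, ← Finset.sum_filter, Finset.sum_const, nsmul_eq_mul, mul_comm]
      refine mul_le_mul_of_nonneg_left ?_ (by norm_num)
      have h1 : (Λ.filter fun x => x ∈ colEdges (0 : Site d) n).card ≤ (colEdges (0 : Site d) n).card :=
        Finset.card_le_card fun x hx => (Finset.mem_filter.1 hx).2
      have h2 : (colEdges (0 : Site d) n).card ≤ n := by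
        unfold colEdges
        exact Finset.card_image_le.trans (Finset.card_range n).le
      exact_mod_cast h1.trans h2
    have hcomp : ∀ (g : LGConfig d G → ℝ), (∀ U, g U = (f U).re) ∨ (∀ U, g U = (f U).im) →
        |(∫ U, g U ∂(ymSpecification ρ β Λ η)) - ∫ U, g U ∂(ymSpecification ρ β Λ (centreTransform g₀ η))| ≤
          2 * Real.exp (-(κ * (((R - 0 - 1) / (n + 2) : ℕ) : ℝ))) * (2 * n) := by
      intro g hg
      have hgm : Measurable g := by
        rcases hg with h | h
        · rw [show g = fun U => (f U).re from funext h]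
          exact (Complex.continuous_re.comp hfc).measurable
        · rw [show g = fun U => (f U).im from funext h]
          exact (Complex.continuous_im.comp hfc).measurable
      have hg1 : ∀ U, |g U| ≤ 1 := fun U => by
        rcases hg with h | h
        · rw [h U]; exact (Complex.abs_re_le_norm _).trans (hf1 U)
        · rw [h U]; exact (Complex.abs_im_le_norm _).trans (hf1 U)
      have hgcyl : DependsOn g (↑(colEdges (0 : Site d) n) : Set (ZdEdge d)) := by
        intro U V hUV
        have hfUV : f U = f V := isCylinder_colMat_apply π 0 n a b hUV
        rcases hg with h | h
        · rw [h U, h V, hfUV]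
        · rw [h U, h V, hfUV]
      have hgdep : DependsOn g (↑Λ : Set (ZdEdge d)) :=
        hgcyl.mono fun x hx => Finset.mem_coe.2 (colEdges_zero_subset_slabBox hR (Finset.mem_coe.1 hx))
      have hglip : ∀ (x : ZdEdge d) (σ σ' : LGConfig d G), (∀ e, e ≠ x → σ e = σ' e) → |g σ - g σ'| ≤ δ x := by
        intro x σ σ' hσ
        by_cases hx : x ∈ colEdges (0 : Site d) n
        · simp only [hδ, if_pos hx]
          calc |g σ - g σ'| ≤ |g σ| + |g σ'| := abs_sub _ _
            _ ≤ 1 + 1 := add_le_add (hg1 σ) (hg1 σ')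
            _ = 2 := by norm_num
        · simp only [hδ, if_neg hx]
          rw [hgcyl fun e he => hσ e fun hex => hx (hex ▸ Finset.mem_coe.1 he), sub_self, abs_zero]
      refine (hbound R 0 η (centreTransform g₀ η) hagree g hgm ⟨1, hg1⟩ hgdep δ hδ0 hglip hδS).trans ?_
      exact mul_le_mul_of_nonneg_left hsumδ (by positivity)
    -- (iii) combine: `‖1 − c‖ ‖I‖ = ‖I − I'‖ ≤ |Re I − Re I'| + |Im I − Im I'|`
    set ε : ℝ := 2 * Real.exp (-(κ * (((R - 0 - 1) / (n + 2) : ℕ) : ℝ))) * (2 * n) with hε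
    have hre : |I.re - I'.re| ≤ ε := by
      have h := hcomp (fun U => (f U).re) (Or.inl fun U => rfl)
      have e1 : I.re = ∫ U, (f U).re ∂(ymSpecification ρ β Λ η) := by
        rw [hI]; exact (integral_re (hfi η)).symm
      have e2 : I'.re = ∫ U, (f U).re ∂(ymSpecification ρ β Λ (centreTransform g₀ η)) := by
        rw [hI']; exact (integral_re (hfi (centreTransform g₀ η))).symm
      rw [e1, e2]; exact h
    have him : |I.im - I'.im| ≤ ε := by
      have h := hcomp (fun U => (f U).im) (Or.inr fun U => rfl)
      have e1 : I.im = ∫ U, (f U).im ∂(ymSpecification ρ β Λ η) := by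
        rw [hI]; exact (integral_im (hfi η)).symm
      have e2 : I'.im = ∫ U, (f U).im ∂(ymSpecification ρ β Λ (centreTransform g₀ η)) := by
        rw [hI']; exact (integral_im (hfi (centreTransform g₀ η))).symm
      rw [e1, e2]; exact h
    have hdiff : ‖(1 : ℂ) - c‖ * ‖I‖ ≤ 2 * ε := by
      have e : ‖(1 : ℂ) - c‖ * ‖I‖ = ‖I - I'‖ := by rw [← norm_mul, hI'c]; ring_nf
      rw [e]
      calc ‖I - I'‖ ≤ |(I - I').re| + |(I - I').im| := Complex.norm_le_abs_re_add_abs_im _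
        _ = |I.re - I'.re| + |I.im - I'.im| := by simp
        _ ≤ ε + ε := add_le_add hre him
        _ = 2 * ε := by ring
    -- (iv) arithmetic: `2ε = 8n e^{−κ q}`, `q = ⌊(R−1)/(n+2)⌋ ≥ R/(n+2) − 1`
    have hq : (R : ℝ) / (n + 2) - 1 ≤ (((R - 0 - 1) / (n + 2) : ℕ) : ℝ) := by
      set q : ℕ := (R - 0 - 1) / (n + 2) with hqdef
      have h1 : R - 0 - 1 < (q + 1) * (n + 2) := by
        have := Nat.lt_div_mul_add (a := R - 0 - 1) (b := n + 2) (by omega)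
        rw [← hqdef] at this
        linarith [this]
      have h1' : R ≤ q * (n + 2) + (n + 2) := by
        have : (q + 1) * (n + 2) = q * (n + 2) + (n + 2) := by ring
        omega
      have h2 : (R : ℝ) ≤ (q : ℝ) * ((n : ℝ) + 2) + ((n : ℝ) + 2) := by exact_mod_cast h1'
      have hn2 : (0 : ℝ) < (n : ℝ) + 2 := by positivity
      rw [div_sub_one hn2.ne', div_le_iff₀ hn2]
      linarith
    have hexp : Real.exp (-(κ * (((R - 0 - 1) / (n + 2) : ℕ) : ℝ))) ≤
        Real.exp κ * Real.exp (-(κ / (n + 2) * R)) := by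
      rw [← Real.exp_add]
      refine Real.exp_le_exp.2 ?_
      have : κ * ((R : ℝ) / (n + 2) - 1) ≤ κ * (((R - 0 - 1) / (n + 2) : ℕ) : ℝ) :=
        mul_le_mul_of_nonneg_left hq hκ.le
      have e : κ * ((R : ℝ) / (n + 2) - 1) = κ / (n + 2) * R - κ := by ring
      linarith
    have hI_le : ‖I‖ ≤ 2 * ε / ‖(1 : ℂ) - c‖ := by
      rw [le_div_iff₀ h1c, mul_comm]; exact hdiff
    refine hI_le.trans ?_
    rw [hε, div_le_iff₀ h1c, div_mul_eq_mul_div, div_mul_cancel₀ _ h1c.ne']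
    have hn0 : (0 : ℝ) ≤ n := Nat.cast_nonneg n
    calc 2 * (2 * Real.exp (-(κ * (((R - 0 - 1) / (n + 2) : ℕ) : ℝ))) * (2 * n))
        = 8 * n * Real.exp (-(κ * (((R - 0 - 1) / (n + 2) : ℕ) : ℝ))) := by ring
      _ ≤ 8 * n * (Real.exp κ * Real.exp (-(κ / (n + 2) * R))) := mul_le_mul_of_nonneg_left hexp (by positivity)
      _ = 8 * n * Real.exp κ * Real.exp (-(κ / (n + 2) * R)) := by ring
  exact Real.iSup_le (fun p => hentry p.1 p.2.1 p.2.2) (by positivity)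

/-! ### §2 Equation (12.1): area-law rate for the Wilson loops -/

/-- ★ **Chatterjee 2021, eq. (12.1): `|⟨W_{R×T}⟩| ≤ e^{(C₁ − C₂ R) T}`-type bound under Definition 2.3**, for every compact
metrisable gauge group: if the Wilson theory `(G, ρ, β)` satisfies `HasStrongExpDecayZd d ρ β` (`d ≥ 2`, continuous `ρ`),
then for every finite-dimensional irreducible continuous unitary `π` acting non-trivially on the centre there are `n ≥ 1`
and `C₁, C₂ > 0` such that EVERY DLR state `μ ∈ ymGibbsMeasures ρ β` satisfies, for every base point, every plane `i ≠ j`,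
every `R ≥ 1` and every `T`,
`‖∫ tr π(hol_{R×T}) dμ‖ ≤ m^{⌊T/n⌋+2} (C₁ e^{−C₂ R})^{⌊T/n⌋}`
— the tree's Theorem 2.2 engine (`norm_integral_trace_rect_le`, conditioning on `⌊T/n⌋` stacked slabs) with the
exponentially small column kernels of `colSup_le_exp_of_strongExpDecayZd_uniform`, transported to all planes by a coordinate
permutation (`map_relabel_edgePerm_mem_ymGibbsMeasures`). For `C₂ R > log(m C₁)` this is an area-law bound
`≤ m² e^{−(C₂R − log(mC₁)) ⌊T/n⌋}`. [cite: Chatterjee2021, §12 eq. (12.1)] -/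
theorem norm_integral_trace_rect_le_exp_of_hasStrongExpDecayZd (hd : 2 ≤ d) (hρ : Continuous ρ) {β : ℝ}
    (hdecay : HasStrongExpDecayZd d ρ β) (hπ : Continuous π) (hπu : ∀ g, π g ∈ Matrix.unitaryGroup (Fin m) ℂ)
    (hirr : Literature.Analysis.Convex.SymmetryAdapted.IsIrrep π) (hg₀ : ∃ g₀ ∈ Subgroup.center G, π g₀ ≠ 1) :
    ∃ n : ℕ, 1 ≤ n ∧ ∃ C₁ C₂ : ℝ, 0 < C₁ ∧ 0 < C₂ ∧
      ∀ μ ∈ ymGibbsMeasures ρ β, ∀ (x : Site d) (i j : Fin d), i ≠ j → ∀ (R T : ℕ), 1 ≤ R →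
        ‖∫ U, (π (walkHolonomy U (rectWalk x i j R T))).trace ∂μ‖ ≤
          (m : ℝ) ^ (T / n + 2) * (C₁ * Real.exp (-(C₂ * R))) ^ (T / n) := by
  classical
  have _ := hd
  obtain ⟨g₀, hg₀, hg₀ne⟩ := hg₀
  -- Schur's lemma: `π(g₀) = c • 1` with `c ≠ 1`
  obtain ⟨c, hc⟩ := Literature.Analysis.Convex.SymmetryAdapted.exists_eq_smul_one_of_comm hirr
    (M := π g₀) fun g => by rw [← map_mul, ← map_mul, Subgroup.mem_center_iff.1 hg₀ g]
  have hc1 : c ≠ 1 := fun h => hg₀ne (by rw [hc, h, one_smul])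
  obtain ⟨K₁, K₂, -, hK₂, hdec⟩ := hdecay
  obtain ⟨C, hC0, hC⟩ := exists_forall_abs_plaquetteObs_le (d := d) ρ hρ
  obtain ⟨n₀, hn₀, hcol⟩ := colSup_le_exp_of_strongExpDecayZd_uniform (m := m) ρ hρ hC0 hC hdec hK₂
  obtain ⟨C₁, C₂, hC₁, hC₂, hs⟩ := hcol n₀ le_rfl π hπ hπu hg₀ hc hc1
  set n := n₀ with hn
  have hn1 : 1 ≤ n := by omega
  refine ⟨n, hn1, C₁, C₂, hC₁, hC₂, fun μ hμ x i j hij R T hR => ?_⟩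
  have hs0 : 0 ≤ C₁ * Real.exp (-(C₂ * R)) := by positivity
  -- the `j = 0` form of the bound, for every DLR state and base point
  have key : ∀ (μ' : Measure (LGConfig d G)), μ' ∈ ymGibbsMeasures ρ β → ∀ (x' : Site d) {i' : Fin d},
      i' ≠ 0 → ‖∫ U, (π (walkHolonomy U (rectWalk x' i' 0 R T))).trace ∂μ'‖ ≤
        (m : ℝ) ^ (T / n + 2) * (C₁ * Real.exp (-(C₂ * R))) ^ (T / n) := fun μ' hμ' x' i' hi' =>
    norm_integral_trace_rect_le ρ π hρ hπ hπu β n hs0 hR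
      (fun η a b => (norm_colKernel_le_colSup ρ π hρ hπu β n R η a b).trans (hs R hR)) hμ' x' hi' T
  by_cases hj : j = 0
  · subst hj; exact key μ hμ x hij
  · -- reduce to the `j = 0` form by a coordinate permutation (as in the tree's proof of Thm. 2.2)
    set σ : Equiv.Perm (Fin d) := Equiv.swap (0 : Fin d) j with hσ
    have hσj : σ j = 0 := by rw [hσ, Equiv.swap_apply_right]
    have hσi : σ i ≠ 0 := by
      intro h
      apply hij
      have : i = σ.symm 0 := (Equiv.eq_symm_apply σ).2 h
      rw [this, hσ, Equiv.symm_swap, Equiv.swap_apply_left]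
    have hΨ : Measurable (relabelConfig (G := G) (edgePerm σ)) := (relabelConfig (edgePerm σ)).measurable
    have hF : Continuous fun U : LGConfig d G =>
        (π (walkHolonomy U (rectWalk (sitePerm σ x) (σ i) (σ j) R T))).trace :=
      (hπ.comp (continuous_walkHolonomy _)).matrix_trace
    have hchange : ∫ U, (π (walkHolonomy U (rectWalk x i j R T))).trace ∂μ =
        ∫ U, (π (walkHolonomy U (rectWalk (sitePerm σ x) (σ i) (σ j) R T))).trace
          ∂(μ.map (relabelConfig (edgePerm σ))) := by
      rw [integral_map hΨ.aemeasurable hF.aestronglyMeasurable]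
      simp only [walkHolonomy_relabel_edgePerm_rectWalk]
    rw [hchange, hσj]
    exact key _ (map_relabel_edgePerm_mem_ymGibbsMeasures ρ hρ β σ hμ) _ hσi

end Slab

end Literature.MathematicalPhysics.QuantumLattice

end
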